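import Literature.RingTheory.FormalGroups.UniversalTypicalLawFE
import Literature.RingTheory.FormalGroups.LawOfLogarithm
import Literature.RingTheory.FormalGroups.FormalGroupDescent
import Mathlib.FieldTheory.Finite.Polynomial
import Mathlib.RingTheory.PowerSeries.Expand
import Mathlib.NumberTheory.Basic
import HarnessLib

/-!
# Hazewinkel's universal `p`-typical formal group law `F_V` over `ℤ[V₁, V₂, …]`
# ([Hazewinkel 1978] §2.2 functional-equation lemma (i), §15.2 Thm. (15.2.3))

Topic `Literature/RingTheory/FormalGroups`; namespace `Literature.RingTheory.FormalGroups`.  One DEFINITION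
(`univTypicalLaw p : FormalGroup (MvPolynomial ℕ ℤ)`) + fully proved theorems; no named fact, no instance, no `sorry`.
Setting as in `TypicalLogarithm.lean`: `K = ℚ[V]` (`V_{i+1} = X i`), `f_V = typLog p = Σ a_n X^{pⁿ}`,
`p·a_{n+1} = Σ_i X_i σ^{i+1}(a_{n-i})`, `σ^j = expand (p^j)`; `F_V(X,Y) = f_V⁻¹(f_V(X) + f_V(Y))`
(`logLawSeries (typLog p)`, file `LawOfLogarithm.lean`).

* §1 `natCast_dvd_coeff_expand_map_sub_pow` — FROBENIUS: for `P₀ ∈ ℤ[V]⟦X_τ⟧`, `σ^j_* P₀(X^{p^j}) ≡ P₀^{p^j} (mod p)`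
  (reduction to `(ℤ/p)[V]`, where `σ = ` Frobenius; Mathlib `MvPowerSeries.map_iterateFrobenius_expand`,
  `MvPolynomial.expand_zmod`, `MvPolynomial.C_dvd_iff_zmod`).
* §2 `typLogFE_mem_range` — HAZEWINKEL'S FUNCTIONAL-EQUATION LEMMA, the integrality statement (iii) for `f_V`: if
  `P = ι_* P₀` is integral (`ι : ℤ[V] ↪ ℚ[V]`) then `[X^d](f_V(P) - Σ_i (X_i/p) f^{(i+1)}(W_{i+1}P)) ∈ ℤ[V]` for every `d`
  (each correction term of `coeff_typLogFE_eq` is `X_i · σ^{i+1}(p^m a_m) · (integral)/1` because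
  `W_{i+1}P ≡ P^{p^{i+1}} (mod p)` gives `(P^{p^{i+1}})^{p^m} ≡ (W_{i+1}P)^{p^m} (mod p^{m+1})`, Mathlib `dvd_sub_pow_of_dvd_sub`).
* §3 `coeff_logLawSeries_typLog_mem_range` — FUNCTIONAL-EQUATION LEMMA (i): **`F_V` has coefficients in `ℤ[V]`**
  (induction on the degree: with `P` the part of `F_V` of degree `< n`, `f_V(F_V) = f_V(X) + f_V(Y)`,
  `f_V(F_V) ≡ f_V(P) + (F_V - P)`, and the functional equation of `f_V`).
* §4 `univTypicalLaw p : FormalGroup (MvPolynomial ℕ ℤ)` — the universal `p`-typical law, with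
  `map_univTypicalLaw` (`ι_* F_V = f_V⁻¹(f_V X + f_V Y)`) and `univTypicalLaw_isComm`.

## References
* [Hazewinkel1978] M. Hazewinkel, *Formal Groups and Applications* (1978), §2.2 (2.2.1)–(2.2.3), §2.4, §15.2 (15.2.2)–(15.2.3).
-/

noncomputable section

namespace Literature.RingTheory.FormalGroups

open MvPolynomial Finset

variable (p : ℕ) [hp : Fact p.Prime]

/-! ## §1 Frobenius: `σ^j_* P(X^{p^j}) ≡ P^{p^j} (mod p)` over `ℤ[V]` -/

section Frobenius

variable {τ : Type*}

/-- Over `(ℤ/p)[V]`, `expand (p^j)` is the `p^j`-th power map. [cite: Hazewinkel1978, §2.4 (2.4.1)] -/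
theorem expand_pow_zmod (j : ℕ) : ∀ f : MvPolynomial ℕ (ZMod p), MvPolynomial.expand (p ^ j) f = f ^ p ^ j := by
  induction j with
  | zero => intro f; simp
  | succ j ih =>
    intro f
    rw [pow_succ', MvPolynomial.expand_mul, ih, MvPolynomial.expand_zmod, ← pow_mul, mul_comm, ← pow_succ']

omit hp in
/-- Coefficientwise divisibility gives divisibility by a constant. [folklore] -/
private theorem C_dvd_of_forall_coeff_dvd {R : Type*} [CommRing R] {c : R} {F : MvPowerSeries τ R}
    (h : ∀ e, c ∣ MvPowerSeries.coeff e F) : (MvPowerSeries.C c : MvPowerSeries τ R) ∣ F := by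
  refine ⟨fun e => Classical.choose (h e), ?_⟩
  ext e
  rw [MvPowerSeries.coeff_C_mul]
  exact Classical.choose_spec (h e)

/-- **Frobenius congruence**: for `P₀ ∈ ℤ[V]⟦X_τ⟧`, every coefficient of `σ^j_* P₀(X^{p^j}) - P₀^{p^j}` is divisible by `p`
(`σ^j = expand (p^j)` reduces to the `p^j`-th power Frobenius on `(ℤ/p)[V]`). [cite: Hazewinkel1978, §2.4 (2.4.1)] -/
theorem natCast_dvd_coeff_expand_map_sub_pow (P₀ : MvPowerSeries τ (MvPolynomial ℕ ℤ)) (j : ℕ) (e : τ →₀ ℕ) :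
    (p : MvPolynomial ℕ ℤ) ∣ MvPowerSeries.coeff e
      (MvPowerSeries.expand (p ^ j) (pow_ne_zero _ hp.out.ne_zero)
        (MvPowerSeries.map (MvPolynomial.expand (p ^ j) : MvPolynomial ℕ ℤ →ₐ[ℤ] MvPolynomial ℕ ℤ).toRingHom P₀) -
        P₀ ^ p ^ j) := by
  set r : MvPolynomial ℕ ℤ →+* MvPolynomial ℕ (ZMod p) := MvPolynomial.map (Int.castRingHom (ZMod p)) with hr
  have hcomp : r.comp (MvPolynomial.expand (p ^ j) : MvPolynomial ℕ ℤ →ₐ[ℤ] MvPolynomial ℕ ℤ).toRingHom =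
      (iterateFrobenius (MvPolynomial ℕ (ZMod p)) p j).comp r := by
    refine RingHom.ext fun a => ?_
    simp only [RingHom.comp_apply, AlgHom.toRingHom_eq_coe, RingHom.coe_coe, hr, MvPolynomial.map_expand,
      expand_pow_zmod, iterateFrobenius_def]
  have key : MvPowerSeries.map r (MvPowerSeries.expand (p ^ j) (pow_ne_zero _ hp.out.ne_zero)
      (MvPowerSeries.map (MvPolynomial.expand (p ^ j) : MvPolynomial ℕ ℤ →ₐ[ℤ] MvPolynomial ℕ ℤ).toRingHom P₀) - P₀ ^ p ^ j) = 0 := by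
    rw [map_sub, MvPowerSeries.map_expand, MvPowerSeries.map_map, hcomp, ← MvPowerSeries.map_map,
      ← MvPowerSeries.map_expand, MvPowerSeries.map_iterateFrobenius_expand, map_pow, sub_self]
    exact hp.out.ne_zero
  have hc := congrArg (MvPowerSeries.coeff e) key
  rw [MvPowerSeries.coeff_map, map_zero] at hc
  have hdvd := (MvPolynomial.C_dvd_iff_zmod p _).mpr hc
  rwa [map_natCast] at hdvd

/-- Series form: `p ∣ σ^j_* P₀(X^{p^j}) - P₀^{p^j}` in `ℤ[V]⟦X_τ⟧`. [cite: Hazewinkel1978, §2.4 (2.4.1)] -/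
theorem natCast_dvd_expand_map_sub_pow (P₀ : MvPowerSeries τ (MvPolynomial ℕ ℤ)) (j : ℕ) :
    (p : MvPowerSeries τ (MvPolynomial ℕ ℤ)) ∣
      MvPowerSeries.expand (p ^ j) (pow_ne_zero _ hp.out.ne_zero)
        (MvPowerSeries.map (MvPolynomial.expand (p ^ j) : MvPolynomial ℕ ℤ →ₐ[ℤ] MvPolynomial ℕ ℤ).toRingHom P₀) -
        P₀ ^ p ^ j := by
  rw [← map_natCast (MvPowerSeries.C (σ := τ) (R := MvPolynomial ℕ ℤ)) p]
  exact C_dvd_of_forall_coeff_dvd (natCast_dvd_coeff_expand_map_sub_pow p P₀ j)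

end Frobenius

/-! ## §2 The functional-equation lemma for `f_V`: integrality of `f_V(P) - Σ (X_i/p) f^{(i+1)}(W_{i+1} P)` -/

section FE

variable {τ : Type*}

omit hp in
/-- `ι ∘ σ^j = σ^j ∘ ι` for `ι : ℤ[V] ↪ ℚ[V]`. [folklore] -/
private theorem map_comp_expand (j : ℕ) :
    (MvPolynomial.expand (p ^ j) : MvPolynomial ℕ ℚ →ₐ[ℚ] MvPolynomial ℕ ℚ).toRingHom.comp
        (MvPolynomial.map (Int.castRingHom ℚ) : MvPolynomial ℕ ℤ →+* MvPolynomial ℕ ℚ) =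
      (MvPolynomial.map (Int.castRingHom ℚ)).comp
        (MvPolynomial.expand (p ^ j) : MvPolynomial ℕ ℤ →ₐ[ℤ] MvPolynomial ℕ ℤ).toRingHom := by
  refine RingHom.ext fun a => ?_
  simp only [RingHom.comp_apply, AlgHom.toRingHom_eq_coe, RingHom.coe_coe, MvPolynomial.map_expand]

/-- **Hazewinkel's functional-equation lemma for `f_V` (integrality of the functional-equation expression on integral
arguments).**  If `P = ι_* P₀` with `P₀ ∈ ℤ[V]⟦X_τ⟧`, `P₀(0) = 0`, then for every `d`
`[X^d] f_V(P) - Σ_{i<|d|} X_i p⁻¹ [X^d] f^{(i+1)}(W_{i+1} P) ∈ ℤ[V]`. [cite: Hazewinkel1978, §2.2 (2.2.3), §2.4] -/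
theorem typLogFE_mem_range (P₀ : MvPowerSeries τ (MvPolynomial ℕ ℤ)) (hP₀ : MvPowerSeries.constantCoeff P₀ = 0)
    (d : τ →₀ ℕ) :
    MvPowerSeries.coeff d (PowerSeries.subst (MvPowerSeries.map (MvPolynomial.map (Int.castRingHom ℚ)) P₀) (typLog p)) -
      ∑ i ∈ range d.degree, X i * MvPolynomial.C (p : ℚ)⁻¹ *
        MvPowerSeries.coeff d (PowerSeries.subst
          (MvPowerSeries.expand (p ^ (i + 1)) (pow_ne_zero _ hp.out.ne_zero)
            (MvPowerSeries.map (MvPolynomial.expand (p ^ (i + 1)) : MvPolynomial ℕ ℚ →ₐ[ℚ] MvPolynomial ℕ ℚ).toRingHom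
              (MvPowerSeries.map (MvPolynomial.map (Int.castRingHom ℚ)) P₀)))
          (PowerSeries.map (MvPolynomial.expand (p ^ (i + 1)) : MvPolynomial ℕ ℚ →ₐ[ℚ] MvPolynomial ℕ ℚ).toRingHom (typLog p)))
      ∈ (MvPolynomial.map (Int.castRingHom ℚ) : MvPolynomial ℕ ℤ →+* MvPolynomial ℕ ℚ).range := by
  set ι : MvPolynomial ℕ ℤ →+* MvPolynomial ℕ ℚ := MvPolynomial.map (Int.castRingHom ℚ) with hι
  set P : MvPowerSeries τ (MvPolynomial ℕ ℚ) := MvPowerSeries.map ι P₀ with hPdef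
  have hP : MvPowerSeries.constantCoeff P = 0 := by
    rw [hPdef, MvPowerSeries.constantCoeff_map, hP₀, map_zero]
  rw [coeff_typLogFE_eq p hP d]
  refine Subring.add_mem _ ⟨MvPowerSeries.coeff d P₀, by rw [hPdef, MvPowerSeries.coeff_map]⟩
    (Subring.sum_mem _ fun i _ => Subring.sum_mem _ fun m _ => ?_)
  set σA : MvPolynomial ℕ ℤ →+* MvPolynomial ℕ ℤ :=
    (MvPolynomial.expand (p ^ (i + 1)) : MvPolynomial ℕ ℤ →ₐ[ℤ] MvPolynomial ℕ ℤ).toRingHom with hσA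
  set σK : MvPolynomial ℕ ℚ →+* MvPolynomial ℕ ℚ :=
    (MvPolynomial.expand (p ^ (i + 1)) : MvPolynomial ℕ ℚ →ₐ[ℚ] MvPolynomial ℕ ℚ).toRingHom with hσK
  set W₀ : MvPowerSeries τ (MvPolynomial ℕ ℤ) :=
    MvPowerSeries.expand (p ^ (i + 1)) (pow_ne_zero _ hp.out.ne_zero) (MvPowerSeries.map σA P₀) with hW₀
  -- `W = ι_* W₀` and the difference is `ι_*` of an integral series
  have hW : MvPowerSeries.expand (p ^ (i + 1)) (pow_ne_zero _ hp.out.ne_zero) (MvPowerSeries.map σK P) =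
      MvPowerSeries.map ι W₀ := by
    rw [hPdef, MvPowerSeries.map_map, hσK, hι, map_comp_expand p (i + 1), ← MvPowerSeries.map_map, hW₀,
      MvPowerSeries.map_expand]
  have hdiff : (P ^ p ^ (i + 1)) ^ p ^ m -
      (MvPowerSeries.expand (p ^ (i + 1)) (pow_ne_zero _ hp.out.ne_zero) (MvPowerSeries.map σK P)) ^ p ^ m =
      MvPowerSeries.map ι ((P₀ ^ p ^ (i + 1)) ^ p ^ m - W₀ ^ p ^ m) := by
    rw [hW, map_sub, map_pow, map_pow, map_pow, hPdef]
  -- `p^{m+1} ∣ W₀^{p^m} - (P₀^{p^{i+1}})^{p^m}`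
  have hdvd : (p : MvPowerSeries τ (MvPolynomial ℕ ℤ)) ^ (m + 1) ∣ W₀ ^ p ^ m - (P₀ ^ p ^ (i + 1)) ^ p ^ m :=
    dvd_sub_pow_of_dvd_sub (natCast_dvd_expand_map_sub_pow p P₀ (i + 1)) m
  obtain ⟨G, hG⟩ := hdvd
  have hcoeff : MvPowerSeries.coeff d ((P₀ ^ p ^ (i + 1)) ^ p ^ m - W₀ ^ p ^ m) =
      -((p : MvPolynomial ℕ ℤ) ^ (m + 1) * MvPowerSeries.coeff d G) := by
    rw [← neg_sub, hG, map_neg, ← map_natCast (MvPowerSeries.C (σ := τ) (R := MvPolynomial ℕ ℤ)) p, ← map_pow,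
      MvPowerSeries.coeff_C_mul]
  rw [hdiff, MvPowerSeries.coeff_map, hcoeff]
  -- the term is `-(X i · σ^{i+1}(p^m a_m) · ι([X^d]G))`
  have hσa : σK ((p : ℚ) ^ m • typLogCoeff p m) ∈ ι.range := by
    obtain ⟨y, hy⟩ := pow_smul_typLogCoeff_mem_range p m
    refine ⟨σA y, ?_⟩
    rw [← hy, ← hι, ← RingHom.comp_apply, ← RingHom.comp_apply, hσK, hι, map_comp_expand p (i + 1)]
  have hval : X i * MvPolynomial.C (p : ℚ)⁻¹ * (MvPolynomial.expand (p ^ (i + 1))) (typLogCoeff p m) *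
      ι (-((p : MvPolynomial ℕ ℤ) ^ (m + 1) * MvPowerSeries.coeff d G)) =
      -(X i * σK ((p : ℚ) ^ m • typLogCoeff p m) * ι (MvPowerSeries.coeff d G)) := by
    rw [map_neg, map_mul, map_pow, map_natCast, hσK, AlgHom.toRingHom_eq_coe, RingHom.coe_coe, map_smul,
      Algebra.smul_def, MvPolynomial.algebraMap_eq]
    have hpC : (p : MvPolynomial ℕ ℚ) = MvPolynomial.C (p : ℚ) := (map_natCast MvPolynomial.C p).symm
    rw [hpC, ← map_pow]
    have hq : (MvPolynomial.C (p : ℚ)⁻¹ : MvPolynomial ℕ ℚ) * MvPolynomial.C ((p : ℚ) ^ (m + 1)) =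
        MvPolynomial.C ((p : ℚ) ^ m) := by
      rw [← map_mul, pow_succ, mul_comm ((p : ℚ) ^ m), ← mul_assoc, inv_mul_cancel₀ (by exact_mod_cast hp.out.ne_zero),
        one_mul]
    linear_combination (-(X i * (MvPolynomial.expand (p ^ (i + 1))) (typLogCoeff p m) * ι (MvPowerSeries.coeff d G))) * hq
  rw [hval]
  exact Subring.neg_mem _ (Subring.mul_mem _ (Subring.mul_mem _ ⟨X i, by rw [hι, MvPolynomial.map_X]⟩ hσa)
    ⟨MvPowerSeries.coeff d G, rfl⟩)

end FE

/-! ## §3 Functional-equation lemma (i): `F_V = f_V⁻¹(f_V X + f_V Y)` has coefficients in `ℤ[V]` -/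

section Integrality

/-- `f^{(j)}(W_j Q) = σ^j_*(f_V(Q))(X^{p^j})` for `Q` without constant term. [cite: Hazewinkel1978, §2.4 (2.4.6)] -/
theorem map_expand_typLog_subst_expand_map {τ : Type*} {Q : MvPowerSeries τ (MvPolynomial ℕ ℚ)}
    (hQ : MvPowerSeries.constantCoeff Q = 0) (j : ℕ) :
    PowerSeries.subst
        (MvPowerSeries.expand (p ^ j) (pow_ne_zero _ hp.out.ne_zero)
          (MvPowerSeries.map (MvPolynomial.expand (p ^ j) : MvPolynomial ℕ ℚ →ₐ[ℚ] MvPolynomial ℕ ℚ).toRingHom Q))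
        (PowerSeries.map (MvPolynomial.expand (p ^ j) : MvPolynomial ℕ ℚ →ₐ[ℚ] MvPolynomial ℕ ℚ).toRingHom (typLog p)) =
      MvPowerSeries.expand (p ^ j) (pow_ne_zero _ hp.out.ne_zero)
        (MvPowerSeries.map (MvPolynomial.expand (p ^ j) : MvPolynomial ℕ ℚ →ₐ[ℚ] MvPolynomial ℕ ℚ).toRingHom
          (PowerSeries.subst Q (typLog p))) := by
  have hQs : PowerSeries.HasSubst Q := PowerSeries.HasSubst.of_constantCoeff_zero hQ
  have hQ' : PowerSeries.HasSubst (MvPowerSeries.map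
      (MvPolynomial.expand (p ^ j) : MvPolynomial ℕ ℚ →ₐ[ℚ] MvPolynomial ℕ ℚ).toRingHom Q) :=
    PowerSeries.HasSubst.of_constantCoeff_zero (by rw [MvPowerSeries.constantCoeff_map, hQ, map_zero])
  rw [PowerSeries.map_subst hQs, PowerSeries.expand_subst _ _ hQ']

/-- **Functional-equation lemma (i) for `f_V`: the law `F_V(X,Y) = f_V⁻¹(f_V(X) + f_V(Y))` has all its coefficients in
`ℤ[V]`.**  Induction on the degree `n = |d|`: with `P` the (integral) part of `F_V` of degree `< n`,
`[X^d]F_V = [X^d](f_V(X) + f_V(Y)) - [X^d] f_V(P)` (`f_V(F_V) ≡ f_V(P) + (F_V - P)`), the arguments `W_j(F_V) ≡ W_j(P)`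
agree far beyond degree `n`, and the functional equation of `f_V` turns `[X^d](f_V X + f_V Y)` into the twisted sums; what is
left is the integral expression of `typLogFE_mem_range`. [cite: Hazewinkel1978, §2.2 (2.2.1), §2.4, §15.2 (15.2.3)] -/
theorem coeff_logLawSeries_typLog_mem_range (d : Fin 2 →₀ ℕ) :
    MvPowerSeries.coeff d (logLawSeries (typLog p) (coeff_one_typLog p)) ∈
      (MvPolynomial.map (Int.castRingHom ℚ) : MvPolynomial ℕ ℤ →+* MvPolynomial ℕ ℚ).range := by
  classical
  set ι : MvPolynomial ℕ ℤ →+* MvPolynomial ℕ ℚ := MvPolynomial.map (Int.castRingHom ℚ) with hι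
  have hιinj : Function.Injective ι := MvPolynomial.map_injective _ Int.cast_injective
  set f := typLog p with hf
  have hf0 : PowerSeries.constantCoeff f = 0 := constantCoeff_typLog p
  have hf1 : PowerSeries.coeff 1 f = 1 := coeff_one_typLog p
  set F : MvPowerSeries (Fin 2) (MvPolynomial ℕ ℚ) := logLawSeries f hf1 with hF
  have hF0 : MvPowerSeries.constantCoeff F = 0 := by
    have h := constantCoeff_logLawSeries_subst f hf1 hf0 (a := (MvPowerSeries.X : Fin 2 → MvPowerSeries (Fin 2) _))
      (fun i => MvPowerSeries.constantCoeff_X i)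
    rwa [MvPowerSeries.subst_self] at h
  -- `f(F) = f(X₀) + f(X₁)`
  have hlogF : PowerSeries.subst F f = PowerSeries.subst (MvPowerSeries.X 0) f + PowerSeries.subst (MvPowerSeries.X 1) f := by
    have h := log_subst_logLawSeries f hf1 hf0 (a := (MvPowerSeries.X : Fin 2 → MvPowerSeries (Fin 2) _))
      (fun i => MvPowerSeries.constantCoeff_X i)
    rwa [MvPowerSeries.subst_self] at h
  -- abbreviations for the twisted objects
  set σK : ℕ → (MvPolynomial ℕ ℚ →+* MvPolynomial ℕ ℚ) := fun j =>
    (MvPolynomial.expand (p ^ j) : MvPolynomial ℕ ℚ →ₐ[ℚ] MvPolynomial ℕ ℚ).toRingHom with hσK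
  set W : ℕ → MvPowerSeries (Fin 2) (MvPolynomial ℕ ℚ) → MvPowerSeries (Fin 2) (MvPolynomial ℕ ℚ) := fun j Q =>
    MvPowerSeries.expand (p ^ j) (pow_ne_zero _ hp.out.ne_zero) (MvPowerSeries.map (σK j) Q) with hW
  set fj : ℕ → PowerSeries (MvPolynomial ℕ ℚ) := fun j => PowerSeries.map (σK j) f with hfj
  -- induction on the degree
  suffices key : ∀ n : ℕ, ∀ e : Fin 2 →₀ ℕ, e.degree < n → MvPowerSeries.coeff e F ∈ ι.range from
    key (d.degree + 1) d (Nat.lt_succ_self _)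
  intro n
  induction n with
  | zero => intro e he; omega
  | succ n ih =>
    intro e he
    by_cases hen : e.degree < n
    · exact ih e hen
    have hdeg : e.degree = n := by omega
    -- degrees 0 and 1
    rcases Nat.lt_or_ge n 2 with hn2 | hn2
    · have hcong := (natCast_le_order_sub_iff.mp (two_le_order_logLawSeries_sub f hf1 hf0)) e (by omega)
      change MvPowerSeries.coeff e F = _ at hcong
      rw [hcong]
      refine ⟨MvPowerSeries.coeff e (MvPowerSeries.X 0 + MvPowerSeries.X 1), ?_⟩
      rw [← MvPowerSeries.coeff_map, map_add, MvPowerSeries.map_X, MvPowerSeries.map_X]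
    -- degree `n ≥ 2`: the integral truncation `P = ι_* P₀` of `F` below degree `n`
    have hex : ∀ e' : Fin 2 →₀ ℕ, e'.degree < n → ∃ a : MvPolynomial ℕ ℤ, ι a = MvPowerSeries.coeff e' F :=
      fun e' he' => RingHom.mem_range.mp (ih e' he')
    set P₀ : MvPowerSeries (Fin 2) (MvPolynomial ℕ ℤ) :=
      fun e' => if h : e'.degree < n then Classical.choose (hex e' h) else 0 with hP₀
    set P : MvPowerSeries (Fin 2) (MvPolynomial ℕ ℚ) := MvPowerSeries.map ι P₀ with hPdef
    have hPlow : ∀ e' : Fin 2 →₀ ℕ, e'.degree < n → MvPowerSeries.coeff e' P = MvPowerSeries.coeff e' F := by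
      intro e' he'
      rw [hPdef, MvPowerSeries.coeff_map, hP₀]
      change ι (if h : e'.degree < n then Classical.choose (hex e' h) else 0) = _
      rw [dif_pos he']
      exact Classical.choose_spec (hex e' he')
    have hPhigh : ∀ e' : Fin 2 →₀ ℕ, ¬ e'.degree < n → MvPowerSeries.coeff e' P = 0 := by
      intro e' he'
      rw [hPdef, MvPowerSeries.coeff_map, hP₀]
      change ι (if h : e'.degree < n then Classical.choose (hex e' h) else 0) = _
      rw [dif_neg he', map_zero]
    have hP0 : MvPowerSeries.constantCoeff P = 0 := by
      rw [← MvPowerSeries.coeff_zero_eq_constantCoeff_apply, hPlow 0 (by simp; omega),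
        MvPowerSeries.coeff_zero_eq_constantCoeff_apply, hF0]
    have hP₀0 : MvPowerSeries.constantCoeff P₀ = 0 := by
      apply hιinj
      rw [← MvPowerSeries.constantCoeff_map, ← hPdef, hP0, map_zero]
    have hFP : ((n : ℕ) : ℕ∞) ≤ (F - P).order :=
      natCast_le_order_sub_iff.mpr fun e' he' => (hPlow e' he').symm
    -- (α) `[X^e] f(P) = [X^e] f(F) - [X^e] F`
    have hα : MvPowerSeries.coeff e (PowerSeries.subst P f) =
        MvPowerSeries.coeff e (PowerSeries.subst F f) - MvPowerSeries.coeff e F := by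
      have h := (natCast_le_order_iff.mp (le_order_psubst_sub_psubst_sub hf0 hf1 (by omega) hF0 hP0 hFP)) e (by omega)
      simp only [map_sub, hPhigh e hen] at h
      linear_combination -h
    -- (γ) the twisted arguments of `F` and `P` agree far beyond degree `n`
    have hγ : ∀ j, 1 ≤ j → MvPowerSeries.coeff e (PowerSeries.subst (W j P) (fj j)) =
        MvPowerSeries.coeff e (PowerSeries.subst (W j F) (fj j)) := by
      intro j hj
      have hWF : MvPowerSeries.constantCoeff (W j F) = 0 := constantCoeff_expand_map p hF0 j
      have hWP : MvPowerSeries.constantCoeff (W j P) = 0 := constantCoeff_expand_map p hP0 j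
      have hord : ((n + 1 : ℕ) : ℕ∞) ≤ (W j F - W j P).order := by
        have e1 : W j F - W j P = MvPowerSeries.expand (p ^ j) (pow_ne_zero _ hp.out.ne_zero)
            (MvPowerSeries.map (σK j) (F - P)) := by
          simp only [hW, map_sub]
        rw [e1, MvPowerSeries.order_expand]
        have h1 : ((n : ℕ) : ℕ∞) ≤ (MvPowerSeries.map (σK j) (F - P)).order := le_trans hFP (MvPowerSeries.le_order_map _)
        have h2 : 2 ≤ p ^ j := le_trans hp.out.two_le (Nat.le_self_pow (by omega) p)
        calc ((n + 1 : ℕ) : ℕ∞) ≤ ((p ^ j * n : ℕ) : ℕ∞) := by exact_mod_cast (by nlinarith)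
          _ = (p ^ j) • ((n : ℕ) : ℕ∞) := by simp
          _ ≤ (p ^ j) • (MvPowerSeries.map (σK j) (F - P)).order := nsmul_le_nsmul_right h1 _
      have h := (natCast_le_order_sub_iff.mp (le_order_psubst_sub_psubst' (fj j) hWP hWF
        (natCast_le_order_sub_comm hord))) e (by omega)
      exact h
    -- (β) `f^{(j)}(W_j F) = f^{(j)}(W_j X₀) + f^{(j)}(W_j X₁)`
    have hβ : ∀ j, PowerSeries.subst (W j F) (fj j) =
        PowerSeries.subst (W j (MvPowerSeries.X 0)) (fj j) + PowerSeries.subst (W j (MvPowerSeries.X 1)) (fj j) := by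
      intro j
      simp only [hW, hfj, hσK]
      rw [map_expand_typLog_subst_expand_map p hF0, map_expand_typLog_subst_expand_map p (MvPowerSeries.constantCoeff_X 0),
        map_expand_typLog_subst_expand_map p (MvPowerSeries.constantCoeff_X 1), ← hf, hlogF, map_add, map_add]
    -- the functional-equation expression of `P` at `e` equals `-[X^e] F`
    have hFE := typLogFE_mem_range p P₀ hP₀0 e
    have hX : ∀ t : Fin 2, MvPowerSeries.coeff e (MvPowerSeries.X t : MvPowerSeries (Fin 2) (MvPolynomial ℕ ℚ)) = 0 := by
      intro t
      rw [MvPowerSeries.coeff_X, if_neg]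
      intro h
      rw [h, Finsupp.degree_single] at hdeg
      omega
    have hval : MvPowerSeries.coeff e (PowerSeries.subst P f) -
        ∑ i ∈ range e.degree, X i * MvPolynomial.C (p : ℚ)⁻¹ * MvPowerSeries.coeff e (PowerSeries.subst (W (i + 1) P) (fj (i + 1))) =
        -MvPowerSeries.coeff e F := by
      have h0 := coeff_typLogFE_X p (0 : Fin 2) e
      have h1 := coeff_typLogFE_X p (1 : Fin 2) e
      rw [hX] at h0 h1
      rw [hα, hlogF, map_add]
      rw [Finset.sum_congr rfl fun i _ => by rw [hγ (i + 1) (by omega), hβ (i + 1), map_add, mul_add],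
        Finset.sum_add_distrib]
      linear_combination h0 + h1
    have hmem : MvPowerSeries.coeff e (PowerSeries.subst P f) -
        ∑ i ∈ range e.degree, X i * MvPolynomial.C (p : ℚ)⁻¹ * MvPowerSeries.coeff e (PowerSeries.subst (W (i + 1) P) (fj (i + 1)))
        ∈ ι.range := hFE
    rw [hval] at hmem
    have := Subring.neg_mem _ hmem
    rwa [neg_neg] at this

end Integrality

/-! ## §4 The universal `p`-typical law over `ℤ[V]` -/

section Law

/-- Injectivity of `ι : ℤ[V] → ℚ[V]`. [folklore] -/
private theorem map_intCast_injective :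
    Function.Injective (MvPolynomial.map (Int.castRingHom ℚ) : MvPolynomial ℕ ℤ →+* MvPolynomial ℕ ℚ) :=
  MvPolynomial.map_injective _ Int.cast_injective

/-- The coefficients of `F_V` have (unique) preimages in `ℤ[V]`. [cite: Hazewinkel1978, §15.2 (15.2.3)] -/
theorem exists_eq_coeff_ofLogarithm_typLog (e : Fin 2 →₀ ℕ) : ∃ a : MvPolynomial ℕ ℤ,
    MvPolynomial.map (Int.castRingHom ℚ) a =
      MvPowerSeries.coeff e (FormalGroup.ofLogarithm (typLog p) (coeff_one_typLog p) (constantCoeff_typLog p)).toPowerSeries :=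
  RingHom.mem_range.mp (coeff_logLawSeries_typLog_mem_range p e)

/-- **Hazewinkel's universal `p`-typical formal group law `F_V` over `ℤ[V] = ℤ[V₁, V₂, …]`** (`V_{i+1} = X i`): the
descent to `ℤ[V]` of `f_V⁻¹(f_V(X) + f_V(Y))`, `f_V = Σ a_n(V) X^{pⁿ}`, `p a_{n+1} = Σ_i X_i σ^{i+1}(a_{n-i})`.
[cite: Hazewinkel1978, §15.2 (15.2.3)] -/
def univTypicalLaw : FormalGroup (MvPolynomial ℕ ℤ) :=
  FormalGroup.descend (FormalGroup.ofLogarithm (typLog p) (coeff_one_typLog p) (constantCoeff_typLog p))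
    (MvPolynomial.map (Int.castRingHom ℚ)) map_intCast_injective (exists_eq_coeff_ofLogarithm_typLog p)

/-- `ι_* F_V = f_V⁻¹(f_V X + f_V Y)` over `ℚ[V]`. [cite: Hazewinkel1978, §15.2 (15.2.3)] -/
theorem map_univTypicalLaw : (univTypicalLaw p).map (MvPolynomial.map (Int.castRingHom ℚ)) =
    FormalGroup.ofLogarithm (typLog p) (coeff_one_typLog p) (constantCoeff_typLog p) :=
  FormalGroup.map_descend _ _ _ _

/-- `ι_* F_V = f_V⁻¹(f_V X + f_V Y)` as series. [cite: Hazewinkel1978, §15.2 (15.2.3)] -/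
theorem map_univTypicalLaw_toPowerSeries :
    MvPowerSeries.map (MvPolynomial.map (Int.castRingHom ℚ)) (univTypicalLaw p).toPowerSeries =
      logLawSeries (typLog p) (coeff_one_typLog p) :=
  congrArg FormalGroup.toPowerSeries (map_univTypicalLaw p)

/-- `F_V` is commutative. [cite: Hazewinkel1978, §15.2 (15.2.3)] -/
theorem univTypicalLaw_isComm : (univTypicalLaw p).IsComm :=
  haveI := FormalGroup.ofLogarithm_isComm (typLog p) (coeff_one_typLog p) (constantCoeff_typLog p)
  FormalGroup.descend_isComm _ _ _ _

/-- **`f_V` is the logarithm of `F_V`**: `f_V(ι_*F_V(a₀,a₁)) = f_V(a₀) + f_V(a₁)` for arguments without constant term.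
[cite: Hazewinkel1978, §15.2 (15.2.3)] -/
theorem typLog_subst_map_univTypicalLaw {τ : Type*} {a : Fin 2 → MvPowerSeries τ (MvPolynomial ℕ ℚ)}
    (ha : ∀ i, MvPowerSeries.constantCoeff (a i) = 0) :
    PowerSeries.subst (MvPowerSeries.subst a
        (MvPowerSeries.map (MvPolynomial.map (Int.castRingHom ℚ)) (univTypicalLaw p).toPowerSeries)) (typLog p) =
      PowerSeries.subst (a 0) (typLog p) + PowerSeries.subst (a 1) (typLog p) := by
  rw [map_univTypicalLaw_toPowerSeries]
  exact log_subst_logLawSeries (typLog p) (coeff_one_typLog p) (constantCoeff_typLog p) ha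

end Law

end Literature.RingTheory.FormalGroups
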